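import Summits.ResolutionOfSingularities.ResolutionOfSingularities.Theorems.PurelyInseparableDim4PureLeafUnitOddThree
import HarnessLib
import HarnessLib.Audit.Tags

/-!
# Purely inseparable fourfolds — UNIFORM THEOREM (every odd `a₀`): every unit leaf `x₀^{c}·x₁^m·x₂^{2b}·x₃^{2d}·(1+x₀)` (`c, m` odd; any even dress) is an A-WIN of the plain game over `𝔽₂` ‖ K
# (cell res-dim4-pi; brick (δ) «unit leaves x^a(1+x_j)», UNIFORM family «a₀ odd, one odd partner, even rest») [OURS · counted 0 · a theorem about OUR coordinate-centre frame v4, not about resolution]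

Width seat `res-dim4-p-10` (g6).  Sequel of `…PureLeafUnitOddPair` (`a₀ = 1`, p727028) and `…PureLeafUnitOddThree`
(`a₀ = 3`, p727909), closing item (2) of the lineage memo `pub/res-dim4/res-dim4-p-10/UNIT-CLASS-TEXT.md` §10 («a₀ ≥ 5 with one
odd partner») for EVERY odd `a₀` at once.  Two families, `c` odd, `m = n + 1` odd, `S² = x₂^{g₂}(1+x₂)^{e₂}x₃^{g₃}(1+x₃)^{e₃}` an
even dress:

* `B_c := x₀^c·x₁^m·(1+x₀)·S²` (the leaf shape; `B_1 = A_m` of `…OddPair`, `B_3 = B` of `…OddThree`);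
* `U_c := x₀^c(1+x₁)^m·S² + x₀^{c+1}x₁(1+x₁)^{m−1}·S² = x₀^c(1+x₁)^{m−1}(1 + x₁ + x₀x₁)·S²` (`U_1 = G̃_m·S²` of `…OddThree`).

A's rule: the singleton `{x₀}` while `c ≥ 3` (chart `x₀` is forced, `b₀ = 0`).  The transitions (`step_F_grind0_Bc`,
`step_F_grind0_Uc`): `B_{c+2} → B_c` (`b₁ = 0`) or `U_c` (`b₁ = 1`); `U_{c+2} → U_c` (`b₁ = 0`) or `B_c` (`b₁ = 1`) — B's dressing
of `x₁` creates the unit `1 + x₁ + x₀x₁`, and B's next swap of `x₁` destroys it again (the only cleanings are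
`clean_even_oddAt`: `x₀^{c+1}(1+x₁)^m S² ↦ x₀^{c+1}x₁(1+x₁)^{m−1}S²` and `x₀^{c+1}x₁^{m−1}(1+x₁)S² ↦ x₀^{c+1}x₁^m S²`); the dress on
`x₂, x₃` is swapped at will.  Hence, by induction on `c` from the two bases in the tree (`stateWins_unitLeaf_oneOdd_dressed`,
`stateWins_G`): **`stateWins_BU`** — `B_c` and `U_c` win for every odd `c`, every odd `m`, every even dress, every booking — and the
leaf forms **`stateWins_unitLeaf_oddOdd`** / **`stateWins_unitLeaf_oddOdd_partner`**: for every `a : Fin 4 → ℕ` with `a₀` ODD, exactly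
one other exponent odd and the remaining two even, and every booking, `StateWins 2 ⟨x^a·(1+x₀), r, exc⟩` over `𝔽₂`.
(The lineage's g5 reading «`a₀ ≥ 5` needs reservoir counting; the liberal two-variable abstraction fails» is superseded: that
abstraction failed only because it lets B translate the chart variable; in the real game `b₀ = 0`.)  Census instances beyond
`{1,2,3}⁴`: 5122, 5221 (previously certificate-only), 5144, 7322, … every size.

Riders: `𝔽₂`-rational replies; the PLAIN coordinate game of OUR frame v4 (`StateWins 2`), not MODE 1h, not CJS; nothing here proves
F4-C(2,2), `Terminates1h 2 2` or resolution of singularities in dimension ≥ 4 / characteristic `p`; counted 0; AI kernel work, weaker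
than expert review. bears_on: LADDER-RESOLUTION:D157-DOOR2 (res-dim4-pi · brick (δ) · unit-leaf row, uniform theorem).
Supports stmt-ResolutionOfSingularities-16155 (helper).
-/

set_option linter.dupNamespace false

open MvPolynomial Finset

open scoped BigOperators

noncomputable section

namespace Summit.ResolutionOfSingularities.ResolutionOfSingularities.Theorems.PIDim4

namespace PureLeafNF

open Literature.AlgebraicGeometry.Resolution
open Literature.AlgebraicGeometry.Resolution.Hauser2010
open CentreBlowup PthPowerFactor

/-! ## 1. Product identities with a general `x₀`-exponent `c` (dress parameters `p q r s`) -/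

/-- `x₀^c(1+x₀)(1+x₁)^{n+1}·S² = x₀^c(1+x₁)^{n+1}·S² + x₀^{c+1}(1+x₁)^{n+1}·S²`. [folklore] -/
theorem split_Bc1 (c n p q r s : ℕ) :
    (∏ l, X l ^ (![c, 0, p, q] : Fin 4 → ℕ) l * (1 + X l) ^ (![1, (n + 1), r, s] : Fin 4 → ℕ) l : MvPolynomial (Fin 4) (ZMod 2)) = (∏ l, X l ^ (![c, 0, p, q] : Fin 4 → ℕ) l * (1 + X l) ^ (![0, (n + 1), r, s] : Fin 4 → ℕ) l : MvPolynomial (Fin 4) (ZMod 2)) + (∏ l, X l ^ (![(c + 1), 0, p, q] : Fin 4 → ℕ) l * (1 + X l) ^ (![0, (n + 1), r, s] : Fin 4 → ℕ) l : MvPolynomial (Fin 4) (ZMod 2)) := by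
  have hI := prod_update_e_succ (![c, 0, p, q] : Fin 4 → ℕ) (![0, (n + 1), r, s] : Fin 4 → ℕ) 0
  have h1 : Function.update (![0, (n + 1), r, s] : Fin 4 → ℕ) 0 ((![0, (n + 1), r, s] : Fin 4 → ℕ) 0 + 1) = (![1, (n + 1), r, s] : Fin 4 → ℕ) := by
    funext l; fin_cases l <;> simp
  have h2 : Function.update (![c, 0, p, q] : Fin 4 → ℕ) 0 ((![c, 0, p, q] : Fin 4 → ℕ) 0 + 1) = (![(c + 1), 0, p, q] : Fin 4 → ℕ) := by
    funext l; fin_cases l <;> simp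
  rw [h1, h2] at hI
  exact hI

/-- `x₀^c x₁^m(1+x₀)·S² = x₀^c x₁^m·S² + x₀^{c+1}x₁^m·S²`. [folklore] -/
theorem Bc_eq_add (c m p q r s : ℕ) :
    (∏ l, X l ^ (![c, m, p, q] : Fin 4 → ℕ) l * (1 + X l) ^ (![1, 0, r, s] : Fin 4 → ℕ) l : MvPolynomial (Fin 4) (ZMod 2)) = (∏ l, X l ^ (![c, m, p, q] : Fin 4 → ℕ) l * (1 + X l) ^ (![0, 0, r, s] : Fin 4 → ℕ) l : MvPolynomial (Fin 4) (ZMod 2)) + (∏ l, X l ^ (![(c + 1), m, p, q] : Fin 4 → ℕ) l * (1 + X l) ^ (![0, 0, r, s] : Fin 4 → ℕ) l : MvPolynomial (Fin 4) (ZMod 2)) := by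
  have hI := prod_update_e_succ (![c, m, p, q] : Fin 4 → ℕ) (![0, 0, r, s] : Fin 4 → ℕ) 0
  have h1 : Function.update (![0, 0, r, s] : Fin 4 → ℕ) 0 ((![0, 0, r, s] : Fin 4 → ℕ) 0 + 1) = (![1, 0, r, s] : Fin 4 → ℕ) := by
    funext l; fin_cases l <;> simp
  have h2 : Function.update (![c, m, p, q] : Fin 4 → ℕ) 0 ((![c, m, p, q] : Fin 4 → ℕ) 0 + 1) = (![(c + 1), m, p, q] : Fin 4 → ℕ) := by
    funext l; fin_cases l <;> simp
  rw [h1, h2] at hI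
  exact hI

/-- `x₀^{c+1}(1+x₁)^{n+1}·S²` (`c` odd, `n` even) cleans to `x₀^{c+1}x₁(1+x₁)^n·S²`. [folklore] -/
theorem clean_Bc_1 (c n p q r s : ℕ) (hc : c % 2 = 1) (hn : n % 2 = 0) (hp : p % 2 = 0) (hq : q % 2 = 0) (hr : r % 2 = 0) (hs : s % 2 = 0) :
    deletePthPowers 2 (∏ l, X l ^ (![(c + 1), 0, p, q] : Fin 4 → ℕ) l * (1 + X l) ^ (![0, (n + 1), r, s] : Fin 4 → ℕ) l : MvPolynomial (Fin 4) (ZMod 2)) = (∏ l, X l ^ (![(c + 1), 1, p, q] : Fin 4 → ℕ) l * (1 + X l) ^ (![0, n, r, s] : Fin 4 → ℕ) l : MvPolynomial (Fin 4) (ZMod 2)) := by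
  have ha : ∀ l, (![(c + 1), 0, p, q] : Fin 4 → ℕ) l % 2 = 0 := by
    intro l; fin_cases l <;> simp <;> omega
  have he : ∀ l, l ≠ (1 : Fin 4) → (![0, (n + 1), r, s] : Fin 4 → ℕ) l % 2 = 0 := by
    intro l hl; fin_cases l <;> simp at hl ⊢ <;> omega
  rw [clean_even_oddAt _ _ 1 ha he (by simp; omega)]
  congr 1; funext l; fin_cases l <;> simp

/-- `x₀^{c+1}x₁^n(1+x₁)·S²` (`c` odd, `n` even) cleans to `x₀^{c+1}x₁^{n+1}·S²`. [folklore] -/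
theorem clean_Uc_01 (c n p q r s : ℕ) (hc : c % 2 = 1) (hn : n % 2 = 0) (hp : p % 2 = 0) (hq : q % 2 = 0) (hr : r % 2 = 0) (hs : s % 2 = 0) :
    deletePthPowers 2 (∏ l, X l ^ (![(c + 1), n, p, q] : Fin 4 → ℕ) l * (1 + X l) ^ (![0, 1, r, s] : Fin 4 → ℕ) l : MvPolynomial (Fin 4) (ZMod 2)) = (∏ l, X l ^ (![(c + 1), (n + 1), p, q] : Fin 4 → ℕ) l * (1 + X l) ^ (![0, 0, r, s] : Fin 4 → ℕ) l : MvPolynomial (Fin 4) (ZMod 2)) := by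
  have ha : ∀ l, (![(c + 1), n, p, q] : Fin 4 → ℕ) l % 2 = 0 := by
    intro l; fin_cases l <;> simp <;> omega
  have he : ∀ l, l ≠ (1 : Fin 4) → (![0, 1, r, s] : Fin 4 → ℕ) l % 2 = 0 := by
    intro l hl; fin_cases l <;> simp at hl ⊢ <;> omega
  rw [clean_even_oddAt _ _ 1 ha he (by simp)]
  congr 1; funext l; fin_cases l <;> simp

/-! ## 2. The transitions under A's singleton `{x₀}` at `B_{c+2}` and `U_{c+2}` -/

/-- **Move `{x₀}` at `B_{c+2} = x₀^{c+2}x₁^{n+1}(1+x₀)·S²** (`c` odd, `n` even, even dress): the reply presents `B_c` with the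
swapped dress (if `b₁ = 0`) or `U_c` (if `b₁ = 1`). [folklore] -/
theorem step_F_grind0_Bc (c n g2 g3 e2 e3 : ℕ) (hc : c % 2 = 1) (hn : n % 2 = 0) (hg2 : g2 % 2 = 0) (hg3 : g3 % 2 = 0) (he2 : e2 % 2 = 0) (he3 : e3 % 2 = 0)
    (b : Fin 4 → ZMod 2) (hb : b 0 = 0) (r : Fin 4 →₀ ℕ) (exc : Finset (Fin 4)) :
    ((step 2 ({0} : Finset (Fin 4)) 0 b (⟨(∏ l, X l ^ (![(c + 2), (n + 1), g2, g3] : Fin 4 → ℕ) l * (1 + X l) ^ (![1, 0, e2, e3] : Fin 4 → ℕ) l : MvPolynomial (Fin 4) (ZMod 2)), r, exc⟩ : State (ZMod 2))).F =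
        (∏ l, X l ^ (![c, (n + 1), (if b 2 = 0 then g2 else e2), (if b 3 = 0 then g3 else e3)] : Fin 4 → ℕ) l * (1 + X l) ^ (![1, 0, (if b 2 = 0 then e2 else g2), (if b 3 = 0 then e3 else g3)] : Fin 4 → ℕ) l : MvPolynomial (Fin 4) (ZMod 2)) ∧ b 1 = 0) ∨
    ((step 2 ({0} : Finset (Fin 4)) 0 b (⟨(∏ l, X l ^ (![(c + 2), (n + 1), g2, g3] : Fin 4 → ℕ) l * (1 + X l) ^ (![1, 0, e2, e3] : Fin 4 → ℕ) l : MvPolynomial (Fin 4) (ZMod 2)), r, exc⟩ : State (ZMod 2))).F =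
        ((∏ l, X l ^ (![c, 0, (if b 2 = 0 then g2 else e2), (if b 3 = 0 then g3 else e3)] : Fin 4 → ℕ) l * (1 + X l) ^ (![0, (n + 1), (if b 2 = 0 then e2 else g2), (if b 3 = 0 then e3 else g3)] : Fin 4 → ℕ) l : MvPolynomial (Fin 4) (ZMod 2)) + (∏ l, X l ^ (![(c + 1), 1, (if b 2 = 0 then g2 else e2), (if b 3 = 0 then g3 else e3)] : Fin 4 → ℕ) l * (1 + X l) ^ (![0, n, (if b 2 = 0 then e2 else g2), (if b 3 = 0 then e3 else g3)] : Fin 4 → ℕ) l : MvPolynomial (Fin 4) (ZMod 2))) ∧ b 1 = 1) := by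
  have hP : ∀ u : ℕ, u % 2 = 0 → ∀ v : ℕ, v % 2 = 0 → ∀ z : ZMod 2, (if z = 0 then u else v) % 2 = 0 := by
    intro u hu v hv z; split_ifs <;> assumption
  have hp' := hP _ hg2 _ he2 (b 2); have hq' := hP _ hg3 _ he3 (b 3); have hr' := hP _ he2 _ hg2 (b 2); have hs' := hP _ he3 _ hg3 (b 3)
  change deletePthPowers 2 (PointBlowup.translate b (chartTransform 2 {0} 0 (∏ l, X l ^ (![(c + 2), (n + 1), g2, g3] : Fin 4 → ℕ) l * (1 + X l) ^ (![1, 0, e2, e3] : Fin 4 → ℕ) l : MvPolynomial (Fin 4) (ZMod 2)))) = _ ∧ _ ∨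
    deletePthPowers 2 (PointBlowup.translate b (chartTransform 2 {0} 0 (∏ l, X l ^ (![(c + 2), (n + 1), g2, g3] : Fin 4 → ℕ) l * (1 + X l) ^ (![1, 0, e2, e3] : Fin 4 → ℕ) l : MvPolynomial (Fin 4) (ZMod 2)))) = _ ∧ _
  rw [translate_chartTransform_singleton_prod (![(c + 2), (n + 1), g2, g3] : Fin 4 → ℕ) (![1, 0, e2, e3] : Fin 4 → ℕ) (i := 0) (by simp) b]
  rcases (by decide : ∀ z : ZMod 2, z = 0 ∨ z = 1) (b 1) with h1 | h1
  · left
    refine ⟨?_, h1⟩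
    rw [show (∏ l, X l ^ (if b l = 0 then Function.update (![(c + 2), (n + 1), g2, g3] : Fin 4 → ℕ) 0 ((![(c + 2), (n + 1), g2, g3] : Fin 4 → ℕ) 0 - 2) l else (![1, 0, e2, e3] : Fin 4 → ℕ) l) *
        (1 + X l) ^ (if b l = 0 then (![1, 0, e2, e3] : Fin 4 → ℕ) l else Function.update (![(c + 2), (n + 1), g2, g3] : Fin 4 → ℕ) 0 ((![(c + 2), (n + 1), g2, g3] : Fin 4 → ℕ) 0 - 2) l) : MvPolynomial (Fin 4) (ZMod 2)) =
        (∏ l, X l ^ (![c, (n + 1), (if b 2 = 0 then g2 else e2), (if b 3 = 0 then g3 else e3)] : Fin 4 → ℕ) l * (1 + X l) ^ (![1, 0, (if b 2 = 0 then e2 else g2), (if b 3 = 0 then e3 else g3)] : Fin 4 → ℕ) l : MvPolynomial (Fin 4) (ZMod 2)) from Finset.prod_congr rfl fun l _ => by fin_cases l <;> simp [h1, hb],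
      deletePthPowers_prod_of_purelyOdd (![c, (n + 1), (if b 2 = 0 then g2 else e2), (if b 3 = 0 then g3 else e3)] : Fin 4 → ℕ) (![1, 0, (if b 2 = 0 then e2 else g2), (if b 3 = 0 then e3 else g3)] : Fin 4 → ℕ) (l := 1) (by simp; omega) (by simp)]
  · right
    refine ⟨?_, h1⟩
    rw [show (∏ l, X l ^ (if b l = 0 then Function.update (![(c + 2), (n + 1), g2, g3] : Fin 4 → ℕ) 0 ((![(c + 2), (n + 1), g2, g3] : Fin 4 → ℕ) 0 - 2) l else (![1, 0, e2, e3] : Fin 4 → ℕ) l) *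
        (1 + X l) ^ (if b l = 0 then (![1, 0, e2, e3] : Fin 4 → ℕ) l else Function.update (![(c + 2), (n + 1), g2, g3] : Fin 4 → ℕ) 0 ((![(c + 2), (n + 1), g2, g3] : Fin 4 → ℕ) 0 - 2) l) : MvPolynomial (Fin 4) (ZMod 2)) =
        (∏ l, X l ^ (![c, 0, (if b 2 = 0 then g2 else e2), (if b 3 = 0 then g3 else e3)] : Fin 4 → ℕ) l * (1 + X l) ^ (![1, (n + 1), (if b 2 = 0 then e2 else g2), (if b 3 = 0 then e3 else g3)] : Fin 4 → ℕ) l : MvPolynomial (Fin 4) (ZMod 2)) from Finset.prod_congr rfl fun l _ => by fin_cases l <;> simp [h1, hb],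
      split_Bc1, deletePthPowers_add,
      deletePthPowers_prod_of_purelyOdd (![c, 0, (if b 2 = 0 then g2 else e2), (if b 3 = 0 then g3 else e3)] : Fin 4 → ℕ) (![0, (n + 1), (if b 2 = 0 then e2 else g2), (if b 3 = 0 then e3 else g3)] : Fin 4 → ℕ) (l := 0) (by simpa using hc) (by simp),
      clean_Bc_1 _ _ _ _ _ _ hc hn hp' hq' hr' hs']

/-- **Move `{x₀}` at `U_{c+2} = x₀^{c+2}(1+x₁)^{n+1}·S² + x₀^{c+3}x₁(1+x₁)^n·S²** (`c` odd, `n` even, even dress): the reply presents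
`U_c` with the swapped dress (if `b₁ = 0`) or `B_c` (if `b₁ = 1`). [folklore] -/
theorem step_F_grind0_Uc (c n g2 g3 e2 e3 : ℕ) (hc : c % 2 = 1) (hn : n % 2 = 0) (hg2 : g2 % 2 = 0) (hg3 : g3 % 2 = 0) (he2 : e2 % 2 = 0) (he3 : e3 % 2 = 0)
    (b : Fin 4 → ZMod 2) (hb : b 0 = 0) (r : Fin 4 →₀ ℕ) (exc : Finset (Fin 4)) :
    ((step 2 ({0} : Finset (Fin 4)) 0 b (⟨((∏ l, X l ^ (![(c + 2), 0, g2, g3] : Fin 4 → ℕ) l * (1 + X l) ^ (![0, (n + 1), e2, e3] : Fin 4 → ℕ) l : MvPolynomial (Fin 4) (ZMod 2)) + (∏ l, X l ^ (![(c + 3), 1, g2, g3] : Fin 4 → ℕ) l * (1 + X l) ^ (![0, n, e2, e3] : Fin 4 → ℕ) l : MvPolynomial (Fin 4) (ZMod 2))), r, exc⟩ : State (ZMod 2))).F =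
        ((∏ l, X l ^ (![c, 0, (if b 2 = 0 then g2 else e2), (if b 3 = 0 then g3 else e3)] : Fin 4 → ℕ) l * (1 + X l) ^ (![0, (n + 1), (if b 2 = 0 then e2 else g2), (if b 3 = 0 then e3 else g3)] : Fin 4 → ℕ) l : MvPolynomial (Fin 4) (ZMod 2)) + (∏ l, X l ^ (![(c + 1), 1, (if b 2 = 0 then g2 else e2), (if b 3 = 0 then g3 else e3)] : Fin 4 → ℕ) l * (1 + X l) ^ (![0, n, (if b 2 = 0 then e2 else g2), (if b 3 = 0 then e3 else g3)] : Fin 4 → ℕ) l : MvPolynomial (Fin 4) (ZMod 2))) ∧ b 1 = 0) ∨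
    ((step 2 ({0} : Finset (Fin 4)) 0 b (⟨((∏ l, X l ^ (![(c + 2), 0, g2, g3] : Fin 4 → ℕ) l * (1 + X l) ^ (![0, (n + 1), e2, e3] : Fin 4 → ℕ) l : MvPolynomial (Fin 4) (ZMod 2)) + (∏ l, X l ^ (![(c + 3), 1, g2, g3] : Fin 4 → ℕ) l * (1 + X l) ^ (![0, n, e2, e3] : Fin 4 → ℕ) l : MvPolynomial (Fin 4) (ZMod 2))), r, exc⟩ : State (ZMod 2))).F =
        (∏ l, X l ^ (![c, (n + 1), (if b 2 = 0 then g2 else e2), (if b 3 = 0 then g3 else e3)] : Fin 4 → ℕ) l * (1 + X l) ^ (![1, 0, (if b 2 = 0 then e2 else g2), (if b 3 = 0 then e3 else g3)] : Fin 4 → ℕ) l : MvPolynomial (Fin 4) (ZMod 2)) ∧ b 1 = 1) := by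
  have hP : ∀ u : ℕ, u % 2 = 0 → ∀ v : ℕ, v % 2 = 0 → ∀ z : ZMod 2, (if z = 0 then u else v) % 2 = 0 := by
    intro u hu v hv z; split_ifs <;> assumption
  have hp' := hP _ hg2 _ he2 (b 2); have hq' := hP _ hg3 _ he3 (b 3); have hr' := hP _ he2 _ hg2 (b 2); have hs' := hP _ he3 _ hg3 (b 3)
  change deletePthPowers 2 (PointBlowup.translate b (chartTransform 2 {0} 0 ((∏ l, X l ^ (![(c + 2), 0, g2, g3] : Fin 4 → ℕ) l * (1 + X l) ^ (![0, (n + 1), e2, e3] : Fin 4 → ℕ) l : MvPolynomial (Fin 4) (ZMod 2)) + (∏ l, X l ^ (![(c + 3), 1, g2, g3] : Fin 4 → ℕ) l * (1 + X l) ^ (![0, n, e2, e3] : Fin 4 → ℕ) l : MvPolynomial (Fin 4) (ZMod 2))))) = _ ∧ _ ∨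
    deletePthPowers 2 (PointBlowup.translate b (chartTransform 2 {0} 0 ((∏ l, X l ^ (![(c + 2), 0, g2, g3] : Fin 4 → ℕ) l * (1 + X l) ^ (![0, (n + 1), e2, e3] : Fin 4 → ℕ) l : MvPolynomial (Fin 4) (ZMod 2)) + (∏ l, X l ^ (![(c + 3), 1, g2, g3] : Fin 4 → ℕ) l * (1 + X l) ^ (![0, n, e2, e3] : Fin 4 → ℕ) l : MvPolynomial (Fin 4) (ZMod 2))))) = _ ∧ _
  simp only [chartTransform_add, MohAlong.translate_add, deletePthPowers_add]
  rw [translate_chartTransform_singleton_prod (![(c + 2), 0, g2, g3] : Fin 4 → ℕ) (![0, (n + 1), e2, e3] : Fin 4 → ℕ) (i := 0) (by simp) b,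
    translate_chartTransform_singleton_prod (![(c + 3), 1, g2, g3] : Fin 4 → ℕ) (![0, n, e2, e3] : Fin 4 → ℕ) (i := 0) (by simp) b]
  rcases (by decide : ∀ z : ZMod 2, z = 0 ∨ z = 1) (b 1) with h1 | h1
  · left
    refine ⟨?_, h1⟩
    rw [show (∏ l, X l ^ (if b l = 0 then Function.update (![(c + 2), 0, g2, g3] : Fin 4 → ℕ) 0 ((![(c + 2), 0, g2, g3] : Fin 4 → ℕ) 0 - 2) l else (![0, (n + 1), e2, e3] : Fin 4 → ℕ) l) *
        (1 + X l) ^ (if b l = 0 then (![0, (n + 1), e2, e3] : Fin 4 → ℕ) l else Function.update (![(c + 2), 0, g2, g3] : Fin 4 → ℕ) 0 ((![(c + 2), 0, g2, g3] : Fin 4 → ℕ) 0 - 2) l) : MvPolynomial (Fin 4) (ZMod 2)) =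
        (∏ l, X l ^ (![c, 0, (if b 2 = 0 then g2 else e2), (if b 3 = 0 then g3 else e3)] : Fin 4 → ℕ) l * (1 + X l) ^ (![0, (n + 1), (if b 2 = 0 then e2 else g2), (if b 3 = 0 then e3 else g3)] : Fin 4 → ℕ) l : MvPolynomial (Fin 4) (ZMod 2)) from
      Finset.prod_congr rfl fun l _ => by fin_cases l <;> simp [h1, hb]]
    rw [show (∏ l, X l ^ (if b l = 0 then Function.update (![(c + 3), 1, g2, g3] : Fin 4 → ℕ) 0 ((![(c + 3), 1, g2, g3] : Fin 4 → ℕ) 0 - 2) l else (![0, n, e2, e3] : Fin 4 → ℕ) l) *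
        (1 + X l) ^ (if b l = 0 then (![0, n, e2, e3] : Fin 4 → ℕ) l else Function.update (![(c + 3), 1, g2, g3] : Fin 4 → ℕ) 0 ((![(c + 3), 1, g2, g3] : Fin 4 → ℕ) 0 - 2) l) : MvPolynomial (Fin 4) (ZMod 2)) =
        (∏ l, X l ^ (![(c + 1), 1, (if b 2 = 0 then g2 else e2), (if b 3 = 0 then g3 else e3)] : Fin 4 → ℕ) l * (1 + X l) ^ (![0, n, (if b 2 = 0 then e2 else g2), (if b 3 = 0 then e3 else g3)] : Fin 4 → ℕ) l : MvPolynomial (Fin 4) (ZMod 2)) from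
      Finset.prod_congr rfl fun l _ => by fin_cases l <;> simp [h1, hb]]
    rw [deletePthPowers_prod_of_purelyOdd (![c, 0, (if b 2 = 0 then g2 else e2), (if b 3 = 0 then g3 else e3)] : Fin 4 → ℕ) (![0, (n + 1), (if b 2 = 0 then e2 else g2), (if b 3 = 0 then e3 else g3)] : Fin 4 → ℕ) (l := 0) (by simpa using hc) (by simp),
      deletePthPowers_prod_of_purelyOdd (![(c + 1), 1, (if b 2 = 0 then g2 else e2), (if b 3 = 0 then g3 else e3)] : Fin 4 → ℕ) (![0, n, (if b 2 = 0 then e2 else g2), (if b 3 = 0 then e3 else g3)] : Fin 4 → ℕ) (l := 1) (by simp) (by simpa using hn)]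
  · right
    refine ⟨?_, h1⟩
    rw [show (∏ l, X l ^ (if b l = 0 then Function.update (![(c + 2), 0, g2, g3] : Fin 4 → ℕ) 0 ((![(c + 2), 0, g2, g3] : Fin 4 → ℕ) 0 - 2) l else (![0, (n + 1), e2, e3] : Fin 4 → ℕ) l) *
        (1 + X l) ^ (if b l = 0 then (![0, (n + 1), e2, e3] : Fin 4 → ℕ) l else Function.update (![(c + 2), 0, g2, g3] : Fin 4 → ℕ) 0 ((![(c + 2), 0, g2, g3] : Fin 4 → ℕ) 0 - 2) l) : MvPolynomial (Fin 4) (ZMod 2)) =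
        (∏ l, X l ^ (![c, (n + 1), (if b 2 = 0 then g2 else e2), (if b 3 = 0 then g3 else e3)] : Fin 4 → ℕ) l * (1 + X l) ^ (![0, 0, (if b 2 = 0 then e2 else g2), (if b 3 = 0 then e3 else g3)] : Fin 4 → ℕ) l : MvPolynomial (Fin 4) (ZMod 2)) from
      Finset.prod_congr rfl fun l _ => by fin_cases l <;> simp [h1, hb]]
    rw [show (∏ l, X l ^ (if b l = 0 then Function.update (![(c + 3), 1, g2, g3] : Fin 4 → ℕ) 0 ((![(c + 3), 1, g2, g3] : Fin 4 → ℕ) 0 - 2) l else (![0, n, e2, e3] : Fin 4 → ℕ) l) *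
        (1 + X l) ^ (if b l = 0 then (![0, n, e2, e3] : Fin 4 → ℕ) l else Function.update (![(c + 3), 1, g2, g3] : Fin 4 → ℕ) 0 ((![(c + 3), 1, g2, g3] : Fin 4 → ℕ) 0 - 2) l) : MvPolynomial (Fin 4) (ZMod 2)) =
        (∏ l, X l ^ (![(c + 1), n, (if b 2 = 0 then g2 else e2), (if b 3 = 0 then g3 else e3)] : Fin 4 → ℕ) l * (1 + X l) ^ (![0, 1, (if b 2 = 0 then e2 else g2), (if b 3 = 0 then e3 else g3)] : Fin 4 → ℕ) l : MvPolynomial (Fin 4) (ZMod 2)) from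
      Finset.prod_congr rfl fun l _ => by fin_cases l <;> simp [h1, hb]]
    rw [deletePthPowers_prod_of_purelyOdd (![c, (n + 1), (if b 2 = 0 then g2 else e2), (if b 3 = 0 then g3 else e3)] : Fin 4 → ℕ) (![0, 0, (if b 2 = 0 then e2 else g2), (if b 3 = 0 then e3 else g3)] : Fin 4 → ℕ) (l := 0) (by simpa using hc) (by simp),
      clean_Uc_01 _ _ _ _ _ _ hc hn hp' hq' hr' hs', Bc_eq_add]

/-! ## 3. The theorems -/

/-- **`B_c` and `U_c` win** for every odd `c`, every odd `m = n + 1`, every even dress, every booking (induction on `c`: the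
singleton `{x₀}`; bases `B_1 = A_m` — `stateWins_unitLeaf_oneOdd_dressed` — and `U_1 = G̃_m·S²` — `stateWins_G`). [OURS · counted 0]
[folklore] -/
theorem stateWins_BU : ∀ k : ℕ, ∀ c n g2 g3 e2 e3 : ℕ, c % 2 = 1 → c ≤ 2 * k + 1 → n % 2 = 0 →
    g2 % 2 = 0 → g3 % 2 = 0 → e2 % 2 = 0 → e3 % 2 = 0 → ∀ (r : Fin 4 →₀ ℕ) (exc : Finset (Fin 4)),
      StateWins 2 (⟨(∏ l, X l ^ (![c, (n + 1), g2, g3] : Fin 4 → ℕ) l * (1 + X l) ^ (![1, 0, e2, e3] : Fin 4 → ℕ) l : MvPolynomial (Fin 4) (ZMod 2)), r, exc⟩ : State (ZMod 2)) ∧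
      StateWins 2 (⟨((∏ l, X l ^ (![c, 0, g2, g3] : Fin 4 → ℕ) l * (1 + X l) ^ (![0, (n + 1), e2, e3] : Fin 4 → ℕ) l : MvPolynomial (Fin 4) (ZMod 2)) + (∏ l, X l ^ (![(c + 1), 1, g2, g3] : Fin 4 → ℕ) l * (1 + X l) ^ (![0, n, e2, e3] : Fin 4 → ℕ) l : MvPolynomial (Fin 4) (ZMod 2))), r, exc⟩ : State (ZMod 2)) := by
  intro k
  induction k with
  | zero =>
    intro c n g2 g3 e2 e3 hc hle hn hg2 hg3 he2 he3 r exc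
    obtain rfl : c = 1 := by omega
    exact ⟨stateWins_unitLeaf_oneOdd_dressed (n + 1) g2 g3 e2 e3 (by omega) hg2 hg3 he2 he3 r exc,
      stateWins_G _ n g2 g3 e2 e3 hn hg2 hg3 he2 he3 le_rfl r exc⟩
  | succ k IH =>
    intro c n g2 g3 e2 e3 hc hle hn hg2 hg3 he2 he3 r exc
    by_cases hck : c ≤ 2 * k + 1
    · exact IH c n g2 g3 e2 e3 hc hck hn hg2 hg3 he2 he3 r exc
    obtain ⟨d, rfl⟩ : ∃ d, c = d + 2 := ⟨c - 2, by omega⟩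
    have hd : d % 2 = 1 := by omega
    have hdk : d ≤ 2 * k + 1 := by omega
    have hstate : ∀ t : State (ZMod 2), t = ⟨t.F, t.r, t.exc⟩ := fun t => rfl
    have hP : ∀ u : ℕ, u % 2 = 0 → ∀ v : ℕ, v % 2 = 0 → ∀ z : ZMod 2, (if z = 0 then u else v) % 2 = 0 := by
      intro u hu v hv z; split_ifs <;> assumption
    refine ⟨?_, ?_⟩
    · -- `B_{d+2}`: the singleton `{x₀}`
      unfold StateWins
      refine Game.Wins.move (m := ({0} : Finset (Fin 4))) ⟨Finset.singleton_nonempty 0, ?_⟩ ?_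
      · show (2 : ℕ∞) ≤ ordAlong {0} (∏ l, X l ^ (![(d + 2), (n + 1), g2, g3] : Fin 4 → ℕ) l * (1 + X l) ^ (![1, 0, e2, e3] : Fin 4 → ℕ) l : MvPolynomial (Fin 4) (ZMod 2))
        rw [ordAlong_prod, degIn_singleton]
        simp
      rintro s' ⟨j', b, hj', hbj, -, -, rfl⟩
      rw [Finset.mem_singleton] at hj'
      subst hj'
      rw [hstate (step 2 _ _ b _)]
      rcases step_F_grind0_Bc d n g2 g3 e2 e3 hd hn hg2 hg3 he2 he3 b hbj r exc with ⟨hF, -⟩ | ⟨hF, -⟩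
      · rw [hF]
        exact (IH d n _ _ _ _ hd hdk hn (hP _ hg2 _ he2 _) (hP _ hg3 _ he3 _) (hP _ he2 _ hg2 _) (hP _ he3 _ hg3 _) _ _).1
      · rw [hF]
        exact (IH d n _ _ _ _ hd hdk hn (hP _ hg2 _ he2 _) (hP _ hg3 _ he3 _) (hP _ he2 _ hg2 _) (hP _ he3 _ hg3 _) _ _).2
    · -- `U_{d+2}`: the singleton `{x₀}`
      unfold StateWins
      refine Game.Wins.move (m := ({0} : Finset (Fin 4))) ⟨Finset.singleton_nonempty 0, ?_⟩ ?_
      · exact two_le_ordAlong_add 0 _ _ _ _ (by simp) (by simp)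
      rintro s' ⟨j', b, hj', hbj, -, -, rfl⟩
      rw [Finset.mem_singleton] at hj'
      subst hj'
      rw [hstate (step 2 _ _ b _)]
      rcases step_F_grind0_Uc d n g2 g3 e2 e3 hd hn hg2 hg3 he2 he3 b hbj r exc with ⟨hF, -⟩ | ⟨hF, -⟩
      · rw [hF]
        exact (IH d n _ _ _ _ hd hdk hn (hP _ hg2 _ he2 _) (hP _ hg3 _ he3 _) (hP _ he2 _ hg2 _) (hP _ he3 _ hg3 _) _ _).2
      · rw [hF]
        exact (IH d n _ _ _ _ hd hdk hn (hP _ hg2 _ he2 _) (hP _ hg3 _ he3 _) (hP _ he2 _ hg2 _) (hP _ he3 _ hg3 _) _ _).1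

/-- **`B_c = x₀^c x₁^m(1+x₀)·S²` wins** (`c, m` odd, every even dress, every booking). [OURS · counted 0] [folklore] -/
theorem stateWins_Bc (c m g2 g3 e2 e3 : ℕ) (hc : c % 2 = 1) (hm : m % 2 = 1) (hg2 : g2 % 2 = 0) (hg3 : g3 % 2 = 0)
    (he2 : e2 % 2 = 0) (he3 : e3 % 2 = 0) (r : Fin 4 →₀ ℕ) (exc : Finset (Fin 4)) :
    StateWins 2 (⟨(∏ l, X l ^ (![c, m, g2, g3] : Fin 4 → ℕ) l * (1 + X l) ^ (![1, 0, e2, e3] : Fin 4 → ℕ) l : MvPolynomial (Fin 4) (ZMod 2)), r, exc⟩ : State (ZMod 2)) := by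
  obtain ⟨n, rfl⟩ : ∃ n, m = n + 1 := ⟨m - 1, by omega⟩
  exact (stateWins_BU c c n g2 g3 e2 e3 hc (by omega) (by omega) hg2 hg3 he2 he3 r exc).1

/-- **`U_c = x₀^c(1+x₁)^m·S² + x₀^{c+1}x₁(1+x₁)^{m−1}·S²` wins** (`c, m` odd, every even dress, every booking). [OURS · counted 0]
[folklore] -/
theorem stateWins_Uc (c n g2 g3 e2 e3 : ℕ) (hc : c % 2 = 1) (hn : n % 2 = 0) (hg2 : g2 % 2 = 0) (hg3 : g3 % 2 = 0)
    (he2 : e2 % 2 = 0) (he3 : e3 % 2 = 0) (r : Fin 4 →₀ ℕ) (exc : Finset (Fin 4)) :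
    StateWins 2 (⟨((∏ l, X l ^ (![c, 0, g2, g3] : Fin 4 → ℕ) l * (1 + X l) ^ (![0, (n + 1), e2, e3] : Fin 4 → ℕ) l : MvPolynomial (Fin 4) (ZMod 2)) + (∏ l, X l ^ (![(c + 1), 1, g2, g3] : Fin 4 → ℕ) l * (1 + X l) ^ (![0, n, e2, e3] : Fin 4 → ℕ) l : MvPolynomial (Fin 4) (ZMod 2))), r, exc⟩ : State (ZMod 2)) :=
  (stateWins_BU c c n g2 g3 e2 e3 hc (by omega) hn hg2 hg3 he2 he3 r exc).2

/-- **UNIFORM THEOREM (unit leaves, `a₀` odd, partner `x₁`).** For every `a` with `a₀` odd, `a₁` odd and `a₂, a₃` even, and every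
booking, the unit leaf `x^a·(1+x₀)` is an A-WIN of the plain game over `𝔽₂`. [OURS · counted 0 · ‖ K] [folklore] -/
theorem stateWins_unitLeaf_oddOdd (a : Fin 4 → ℕ) (h0 : a 0 % 2 = 1) (h1 : a 1 % 2 = 1) (h2 : a 2 % 2 = 0) (h3 : a 3 % 2 = 0)
    (r : Fin 4 →₀ ℕ) (exc : Finset (Fin 4)) :
    StateWins 2 (⟨monomial (Finsupp.equivFunOnFinite.symm a) 1 * (1 + X 0), r, exc⟩ : State (ZMod 2)) := by
  have ha : a = (![a 0, a 1, a 2, a 3] : Fin 4 → ℕ) := by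
    funext l; fin_cases l <;> simp
  have hF : (monomial (Finsupp.equivFunOnFinite.symm a) 1 * (1 + X 0) : MvPolynomial (Fin 4) (ZMod 2)) =
      (∏ l, X l ^ (![(a 0), (a 1), (a 2), (a 3)] : Fin 4 → ℕ) l * (1 + X l) ^ (![1, 0, 0, 0] : Fin 4 → ℕ) l : MvPolynomial (Fin 4) (ZMod 2)) := by
    rw [prod_eq_monomial_mul, Fin.prod_univ_four, ← ha]
    simp
  rw [hF]
  exact stateWins_Bc (a 0) (a 1) (a 2) (a 3) 0 0 h0 h1 h2 h3 (by decide) (by decide) r exc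

/-- **UNIFORM THEOREM (unit leaves, `a₀` odd, one odd partner ANYWHERE).** For `k ≠ 0` and every exponent vector `a` with `a₀` odd,
`a_k` odd and the two other exponents even, and every booking, the unit leaf `x^a·(1+x₀)` is an A-WIN of the plain game over `𝔽₂`.
[OURS · counted 0 · ‖ K] [folklore] -/
theorem stateWins_unitLeaf_oddOdd_partner (k : Fin 4) (hk : k ≠ 0) (a : Fin 4 → ℕ) (h0 : a 0 % 2 = 1) (hk1 : a k % 2 = 1)
    (hev : ∀ i, i ≠ 0 → i ≠ k → a i % 2 = 0) (r : Fin 4 →₀ ℕ) (exc : Finset (Fin 4)) :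
    StateWins 2 (⟨monomial (Finsupp.equivFunOnFinite.symm a) 1 * (1 + X 0), r, exc⟩ : State (ZMod 2)) := by
  -- transport along a renaming fixing `x₀`, as in `…PureLeafUnitOddPairRename` / `…PureLeafUnitOddThree`
  have key : ∀ (e : Equiv.Perm (Fin 4)), e 0 = 0 → a (e 1) % 2 = 1 → a (e 2) % 2 = 0 → a (e 3) % 2 = 0 →
      StateWins 2 (⟨monomial (Finsupp.equivFunOnFinite.symm a) 1 * (1 + X 0), r, exc⟩ : State (ZMod 2)) := by
    intro e he0 he1 he2 he3
    have h' := stateWins_unitLeaf_oddOdd (fun i => a (e i)) (by simp [he0, h0]) he1 he2 he3 r exc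
    have hren := WinCertF.stateWins_rebook (PureLeafGlobalWin.stateWins_rename e 2 h') r exc
    have hd : Finsupp.mapDomain (⇑e) (Finsupp.equivFunOnFinite.symm fun i => a (e i)) = Finsupp.equivFunOnFinite.symm a := by
      ext i
      rw [Finsupp.mapDomain_equiv_apply]
      simp
    have hF : (State.rename e (⟨monomial (Finsupp.equivFunOnFinite.symm fun i => a (e i)) 1 * (1 + X 0), r, exc⟩ :
        State (ZMod 2))).F = monomial (Finsupp.equivFunOnFinite.symm a) 1 * (1 + X 0) := by
      show rename e (monomial (Finsupp.equivFunOnFinite.symm fun i => a (e i)) 1 * (1 + X 0) : MvPolynomial (Fin 4) (ZMod 2)) = _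
      rw [map_mul, rename_monomial, hd, map_add, map_one (rename (⇑e)), rename_X, he0]
    rw [hF] at hren
    exact hren
  fin_cases k
  · exact absurd rfl hk
  · exact key (Equiv.refl _) rfl hk1 (hev 2 (by decide) (by decide)) (hev 3 (by decide) (by decide))
  · exact key (Equiv.swap 1 2) (by decide) (by simpa using hk1) (by simpa using hev 1 (by decide) (by decide))
      (by simpa [Equiv.swap_apply_of_ne_of_ne] using hev 3 (by decide) (by decide))
  · exact key (Equiv.swap 1 3) (by decide) (by simpa using hk1)
      (by simpa [Equiv.swap_apply_of_ne_of_ne] using hev 2 (by decide) (by decide)) (by simpa using hev 1 (by decide) (by decide))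

end PureLeafNF

end Summit.ResolutionOfSingularities.ResolutionOfSingularities.Theorems.PIDim4

end
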